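import Summits.ResolutionOfSingularities.ResolutionOfSingularities.Theorems.EquisingularLiftEquisingularLiftNatDepthClosedPoints
import Summits.ResolutionOfSingularities.ResolutionOfSingularities.Theorems.EquisingularLiftEquisingularLiftNatRouteCurrency
import HarnessLib

/-!
# [OURS] THE DEPTH THEOREMS IN THE STUBS' OWN CURRENCY: finite non-regular locus + finite blow-up depth ⟹ `ELNatConclusionO` (and `ELNatAt`)
# (cruxes `Theses.EquisingularLift.EquisingularLiftNat` / `…NatThree`, stmt-ResolutionOfSingularities-20038 / -20148)

[OURS · leafhand-res-equisingularlift-10 g1, 2026-08-31; cell `pub/decomp-res`] AI-produced, weaker than expert review; NOT a statement of any manuscript;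
nothing here proves resolution of singularities in positive characteristic.  DEF-FREE helper; no `sorry`; standard axioms; ZERO named hypotheses.

The registered isolated residual stub `stub_elnat_three_isolated_nonNDLeaves9` reads «`p` prime, `k = k̄` of characteristic `p`, `H ⊆ ℙⁿ_k` integral closed
with locally principal ideal, `n = 3`, `H` not regular, FINITE non-regular locus, `¬ IsoHypPoint`, ¬ (twelve more classes) ⟹ `ELNatConclusionO k n H ι`».
Here is the positive statement this programme certifies, in that currency and for EVERY `n`: replace all the `¬`-hypotheses by «every non-regular point has a
finite blow-up depth» —

* ★★★ `elNatAt_of_finite_nonRegularLocus_tower` / `elnatO_of_finite_nonRegularLocus_tower` — **`p`, `k`, `H`, `ι`, `hloc` as in the stub, the non-regular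
  locus finite, `D` any blow-up tower (`hD0`, `hDsucc`), every non-regular point of some `D`-level ⟹ `ELNatAt p k n H ι`, resp. `ELNatConclusionO k n H ι`**
  (✓ `isoHypPoint_of_finite_nonRegularLocus_tower` p831421 ⟶ ✓ `elNatAt_of_isoHypPoint` p829027 ⟶ ✓ `RouteCurrency.elnatO_of_elNatAt`);
* ★★ `elnatO_of_finite_nonRegularLocus_of_levels` — the same for an abstract depth-graded `D` with UNFOLDING + LOCALITY;
* ★★ `elnatO_or_exists_infinite_depth` — **the DICHOTOMY for the stub's binders with finite non-regular locus: `ELNatConclusionO k n H ι` holds, OR some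
  non-regular point has infinite intrinsic blow-up depth** — what remains of the isolated residual is exactly the second alternative.

Honest label: closes no registered stub; certifies the sub-class «absolutely point-resolvable isolated singularities» of the isolated residual in the stub's
currency, every dimension `n`, every characteristic.

References: [StacksProject, Tags 080E, 02OS]; [Matsumura1987, Thm. 30.5]; [Hartshorne1977, II Ex. 7.12, V 3.9] — through the cited tree files.
-/

set_option linter.dupNamespace false -- mandated namespace `Summit.<Summit>.<Problem>` of this single-conjunct summit

noncomputable section

open CategoryTheory CategoryTheory.Limits AlgebraicGeometry TopologicalSpace
open Literature.AlgebraicGeometry.Resolution Literature.AlgebraicGeometry.Motives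
open AlgebraicGeometry.Scheme.IdealSheafData
open Summit.ResolutionOfSingularities.ResolutionOfSingularities.Theorems.EquisingularLift

namespace Summit.ResolutionOfSingularities.ResolutionOfSingularities.Cruxes.EquisingularLiftNat.Sections

/-- ★★★ **FINITE NON-REGULAR LOCUS + FINITE INTRINSIC BLOW-UP DEPTH ⟹ `ELNatAt`** (the route decls' per-`H` body), for the stub's binders: `p` prime,
`k = k̄` of characteristic `p`, `H ⊆ ℙⁿ_k` integral closed with locally principal ideal, `D` a blow-up tower, every non-regular point of some `D`-level
(✓ `isoHypPoint_of_finite_nonRegularLocus_tower` ⟶ ✓ `elNatAt_of_isoHypPoint`). [OURS] [cite: StacksProject, Tag 080E] -/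
theorem elNatAt_of_finite_nonRegularLocus_tower (p : ℕ) (hp : p.Prime) (k : Type) [Field k] [CharP k p] [IsAlgClosed k] (n : ℕ) (H : Scheme.{0})
    (ι : H ⟶ (projectiveSpace n k).left) (hι : IsClosedImmersion ι) (hH : IsIntegral H)
    (hloc : ∀ y : (projectiveSpace n k).left, ∃ U : (projectiveSpace n k).left.affineOpens,
      y ∈ (U : (projectiveSpace n k).left.Opens) ∧ (ι.ker.ideal U).IsPrincipal)
    (D : ℕ → ∀ Γ : Scheme.{0}, Γ → Prop)
    (hD0 : ∀ (Γ : Scheme.{0}) (y : Γ), IsClosed (({y} : Set Γ)) →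
      (D 0 Γ y ↔ ∀ (hy : IsClosed (({y} : Set Γ))) (Z : Scheme.{0}) (τ : Z ⟶ Γ), IsBlowup τ (vanishingIdeal ⟨{y}, hy⟩) →
        ∀ z : Z, τ z = y → IsRegularLocalRing (Z.presheaf.stalk z)))
    (hDsucc : ∀ (d : ℕ) (Γ : Scheme.{0}) (y : Γ), IsClosed (({y} : Set Γ)) →
      (D (d + 1) Γ y ↔ ∀ (hy : IsClosed (({y} : Set Γ))) (Z : Scheme.{0}) (τ : Z ⟶ Γ), IsBlowup τ (vanishingIdeal ⟨{y}, hy⟩) →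
        ∃ S' : Finset Z, (∀ z : Z, τ z = y → z ∉ S' → IsRegularLocalRing (Z.presheaf.stalk z)) ∧
          ∀ z ∈ S', τ z = y ∧ IsClosed (({z} : Set Z)) ∧ ∃ d' ≤ d, D d' Z z))
    (hfin : Set.Finite {x : H | ¬ IsRegularLocalRing (H.presheaf.stalk x)})
    (hdepth : ∀ x : H, ¬ IsRegularLocalRing (H.presheaf.stalk x) → ∃ d, D d H x) :
    ELNatAt p k n H ι :=
  elNatAt_of_isoHypPoint p hp k n H ι hι hH hloc (isoHypPoint_of_finite_nonRegularLocus_tower k n H ι D hD0 hDsucc hfin hdepth)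

/-- ★★★ **FINITE NON-REGULAR LOCUS + FINITE INTRINSIC BLOW-UP DEPTH ⟹ `ELNatConclusionO`** — the registered stubs' conclusion, for their own binders and
EVERY `n` (`elNatAt_of_finite_nonRegularLocus_tower` ⟶ ✓ `RouteCurrency.elnatO_of_elNatAt`). [OURS] [cite: StacksProject, Tag 080E] -/
theorem elnatO_of_finite_nonRegularLocus_tower (p : ℕ) (hp : p.Prime) (k : Type) [Field k] [CharP k p] [IsAlgClosed k] (n : ℕ) (H : Scheme.{0})
    (ι : H ⟶ (projectiveSpace n k).left) (hι : IsClosedImmersion ι) (hH : IsIntegral H)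
    (hloc : ∀ y : (projectiveSpace n k).left, ∃ U : (projectiveSpace n k).left.affineOpens,
      y ∈ (U : (projectiveSpace n k).left.Opens) ∧ (ι.ker.ideal U).IsPrincipal)
    (D : ℕ → ∀ Γ : Scheme.{0}, Γ → Prop)
    (hD0 : ∀ (Γ : Scheme.{0}) (y : Γ), IsClosed (({y} : Set Γ)) →
      (D 0 Γ y ↔ ∀ (hy : IsClosed (({y} : Set Γ))) (Z : Scheme.{0}) (τ : Z ⟶ Γ), IsBlowup τ (vanishingIdeal ⟨{y}, hy⟩) →
        ∀ z : Z, τ z = y → IsRegularLocalRing (Z.presheaf.stalk z)))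
    (hDsucc : ∀ (d : ℕ) (Γ : Scheme.{0}) (y : Γ), IsClosed (({y} : Set Γ)) →
      (D (d + 1) Γ y ↔ ∀ (hy : IsClosed (({y} : Set Γ))) (Z : Scheme.{0}) (τ : Z ⟶ Γ), IsBlowup τ (vanishingIdeal ⟨{y}, hy⟩) →
        ∃ S' : Finset Z, (∀ z : Z, τ z = y → z ∉ S' → IsRegularLocalRing (Z.presheaf.stalk z)) ∧
          ∀ z ∈ S', τ z = y ∧ IsClosed (({z} : Set Z)) ∧ ∃ d' ≤ d, D d' Z z))
    (hfin : Set.Finite {x : H | ¬ IsRegularLocalRing (H.presheaf.stalk x)})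
    (hdepth : ∀ x : H, ¬ IsRegularLocalRing (H.presheaf.stalk x) → ∃ d, D d H x) :
    ELNatConclusionO k n H ι :=
  RouteCurrency.elnatO_of_elNatAt p hp k n H ι hι hH
    (elNatAt_of_finite_nonRegularLocus_tower p hp k n H ι hι hH hloc D hD0 hDsucc hfin hdepth)

/-- ★★ **The same for an ABSTRACT depth-graded point-property** `D` with UNFOLDING (`hDstep`) and LOCALITY (`hDloc`)
(✓ `isoHypPoint_of_finite_nonRegularLocus_of_levels`). [OURS] [cite: StacksProject, Tag 080E] -/
theorem elnatO_of_finite_nonRegularLocus_of_levels (p : ℕ) (hp : p.Prime) (k : Type) [Field k] [CharP k p] [IsAlgClosed k] (n : ℕ) (H : Scheme.{0})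
    (ι : H ⟶ (projectiveSpace n k).left) (hι : IsClosedImmersion ι) (hH : IsIntegral H)
    (hloc : ∀ y : (projectiveSpace n k).left, ∃ U : (projectiveSpace n k).left.affineOpens,
      y ∈ (U : (projectiveSpace n k).left.Opens) ∧ (ι.ker.ideal U).IsPrincipal)
    (D : ℕ → ∀ Γ : Scheme.{0}, Γ → Prop)
    (hDstep : ∀ (d : ℕ) (Γ : Scheme.{0}) (y : Γ), D d Γ y → ∀ (hy : IsClosed (({y} : Set Γ))) (Z : Scheme.{0}) (τ : Z ⟶ Γ), IsBlowup τ (vanishingIdeal ⟨{y}, hy⟩) →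
        ∃ S' : Finset Z, (∀ z : Z, τ z = y → z ∉ S' → IsRegularLocalRing (Z.presheaf.stalk z)) ∧
          ∀ z ∈ S', τ z = y ∧ IsClosed (({z} : Set Z)) ∧ ∃ d' < d, D d' Z z)
    (hDloc : ∀ (d : ℕ) (Γ Γ₂ : Scheme.{0}) (ρ : Γ₂ ⟶ Γ) (U : Γ.Opens), IsIso (ρ ∣_ U) → ∀ y : Γ, y ∈ U → IsClosed (({y} : Set Γ)) →
      ∀ y₂ : Γ₂, ρ y₂ = y → IsClosed (({y₂} : Set Γ₂)) → (D d Γ y ↔ D d Γ₂ y₂))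
    (hfin : Set.Finite {x : H | ¬ IsRegularLocalRing (H.presheaf.stalk x)})
    (hdepth : ∀ x : H, ¬ IsRegularLocalRing (H.presheaf.stalk x) → ∃ d, D d H x) :
    ELNatConclusionO k n H ι :=
  RouteCurrency.elnatO_of_elNatAt p hp k n H ι hι hH
    (elNatAt_of_isoHypPoint p hp k n H ι hι hH hloc (isoHypPoint_of_finite_nonRegularLocus_of_levels k n H ι D hDstep hDloc hfin hdepth))

/-- ★★ **THE DICHOTOMY.**  For the stub's binders with FINITE non-regular locus and any blow-up tower `D`: either `ELNatConclusionO k n H ι` holds, or some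
non-regular point of `H` has infinite intrinsic blow-up depth (`∀ d, ¬ D d H x`).  The isolated residual of the registered skeleton is the second branch.
[OURS] [cite: StacksProject, Tag 080E] -/
theorem elnatO_or_exists_infinite_depth (p : ℕ) (hp : p.Prime) (k : Type) [Field k] [CharP k p] [IsAlgClosed k] (n : ℕ) (H : Scheme.{0})
    (ι : H ⟶ (projectiveSpace n k).left) (hι : IsClosedImmersion ι) (hH : IsIntegral H)
    (hloc : ∀ y : (projectiveSpace n k).left, ∃ U : (projectiveSpace n k).left.affineOpens,
      y ∈ (U : (projectiveSpace n k).left.Opens) ∧ (ι.ker.ideal U).IsPrincipal)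
    (D : ℕ → ∀ Γ : Scheme.{0}, Γ → Prop)
    (hD0 : ∀ (Γ : Scheme.{0}) (y : Γ), IsClosed (({y} : Set Γ)) →
      (D 0 Γ y ↔ ∀ (hy : IsClosed (({y} : Set Γ))) (Z : Scheme.{0}) (τ : Z ⟶ Γ), IsBlowup τ (vanishingIdeal ⟨{y}, hy⟩) →
        ∀ z : Z, τ z = y → IsRegularLocalRing (Z.presheaf.stalk z)))
    (hDsucc : ∀ (d : ℕ) (Γ : Scheme.{0}) (y : Γ), IsClosed (({y} : Set Γ)) →
      (D (d + 1) Γ y ↔ ∀ (hy : IsClosed (({y} : Set Γ))) (Z : Scheme.{0}) (τ : Z ⟶ Γ), IsBlowup τ (vanishingIdeal ⟨{y}, hy⟩) →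
        ∃ S' : Finset Z, (∀ z : Z, τ z = y → z ∉ S' → IsRegularLocalRing (Z.presheaf.stalk z)) ∧
          ∀ z ∈ S', τ z = y ∧ IsClosed (({z} : Set Z)) ∧ ∃ d' ≤ d, D d' Z z))
    (hfin : Set.Finite {x : H | ¬ IsRegularLocalRing (H.presheaf.stalk x)}) :
    ELNatConclusionO k n H ι ∨ ∃ x : H, ¬ IsRegularLocalRing (H.presheaf.stalk x) ∧ ∀ d : ℕ, ¬ D d H x := by
  by_cases h : ∀ x : H, ¬ IsRegularLocalRing (H.presheaf.stalk x) → ∃ d, D d H x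
  · exact Or.inl (elnatO_of_finite_nonRegularLocus_tower p hp k n H ι hι hH hloc D hD0 hDsucc hfin h)
  · push Not at h
    exact Or.inr h

end Summit.ResolutionOfSingularities.ResolutionOfSingularities.Cruxes.EquisingularLiftNat.Sections

end
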